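import Summits.AnomalousDissipation.AnomalousDissipation.Theorems.TaylorCertificatesTargetImpliesSteadyDirect
import Literature.Analysis.FluidPDE.StatisticalSolutionEnergyEq
import Literature.Analysis.FunctionSpaces.TorusSobolevSpaceProofs

/-!
# `TaylorCertificates.FloorCertificateEnsembleCeiling` (stmt-AnomalousDissipation-14086) — negative side I:
# the steady pinch, coupled budgets, no super-laminar floor, load-bearing small viscosity

Crux `X = FloorCertificateEnsembleCeiling` (route TaylorCertificates, rank-0 TARGET): ONE smooth solenoidal mean-zero
force `f` and `ε₀, E, ν₀ > 0` such that at every `ν ∈ (0, ν₀)`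
* FLOOR: some cylindrical `Φ₁` and `θ₁ ≤ 0` with `ε₀ ≤ ν‖∇u‖² + ⟨F(u), Φ₁'(u)⟩ + 2θ₁((u,f) − ν‖∇u‖²)` at every
  finite-enstrophy state `u ∈ H` of the Leray ball `|u|² ≤ 16‖f‖²/ν²`;
* CEILING: every stationary statistical solution of `NS_ν(f)` with integrable energy has mean energy `≤ E`.

This file (cdisprove seat `refuter-cdisprove-stmt-AnomalousDissipation-14086-g2-0`, 2026-08-16; the kernel-checked
content of the crux work file `Cruxes/FloorCertificateEnsembleCeiling/Disproof.lean` §B, §C, §D.1, §G.2, re-based so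
that it imports NOTHING from `Theorems/FloorCertificate/Negative/*` / `Theorems/EnsembleCeiling/Negative/*` — those
modules name the route declarations `FloorCertificate` / `EnsembleCeiling` dropped at route rev 13 and no longer build;
written WITHOUT auxiliary definitions, the FLOOR / CEILING blocks of `X` appear verbatim) records what every witness of
`X` must satisfy and which strengthenings / weakenings of `X` are FALSE, for EVERY force:

* `steady_pinch` — THE PINCH ON ATOMS: under FLOOR ∧ CEILING at `(f, ε₀, E, ν)` every steady weak solution `u ∈ V` of
  `NS_ν(f)` is loud, bounded and rough: `ε₀ ≤ ν‖∇u‖² = (u,f) ≤ |u| ‖f‖₂`, `|u|² ≤ E`, `‖∇u‖² ≥ ε₀/ν` (Dirac weak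
  duality `floor_le_dissipation_of_steady` + Dirac ceiling `norm_sq_le_of_ensemble_ceiling`, both of
  `TaylorCertificatesTargetImpliesSteadyDirect`);
* `pair_constants`, `force_pos_of_pair`, `target_constants` — Leray–Temam steady states exist at every `ν`
  (`Temam1979_exists_steadyWeakSolution_holds`), so the two budgets are COUPLED: `ε₀² ≤ ‖f‖₂² E`, `E > 0`, and
  `f ≠ 0` although `X` never says so;
* `floorCertificateEnsembleCeiling_superLaminar_false` — REFUTED STRENGTHENING: no certified floor above the laminar
  power, `‖f‖₂² E < ε₀²` is impossible (the pair certifies at best SATURATION `Re ≍ Gr^{1/2}`, never beats it);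
* `target_false_of_not_steadyStatesLoudBounded` — a refutation of the route's crux #3 refutes `X`;
* `steady_dissipation_le`, `not_floor_of_large_viscosity`, `floor_budget_le` — every steady state has
  `ν‖∇u‖² ≤ ‖f‖₂²/(4π²ν)`, so a floor at `ν` has budget `ε₀ ≤ ‖f‖₂²/(4π²ν)`;
  `floorCertificateEnsembleCeiling_false_without_smallViscosity` — LOAD-BEARING `ν < ν₀`: with the restriction
  dropped the crux is false for EVERY force (the laminar steady state at `ν = ‖f‖₂²/(4π²ε₀) + 1` is quiet);
* `target_false_of_quietOrFatSteadyStates` — the exact STEADY adversary: a quiet (`ν‖∇u‖² < ε₀`) OR fat (`|u|² > E`)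
  steady state in `V` at arbitrarily small `ν`, for every admissible `f ≠ 0` and every box, kills `X` (negative lemma
  modulo an OPEN hypothesis; the known instances are force-class-specific).

Companions: `Negative/InertialBound.lean` (no sub-inertial ceiling: `E ≥ ‖f‖₂²/‖∇f‖_∞`), `Negative/EnsemblePinch.lean`.
-/

noncomputable section

set_option linter.dupNamespace false

open MeasureTheory UnitAddTorus Filter Topology
open scoped InnerProductSpace ENNReal

namespace Summit.AnomalousDissipation.AnomalousDissipation.Theorems.FloorCertificateEnsembleCeiling.Negative

open Literature.Analysis.FunctionSpaces Literature.Analysis.FluidPDE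
open Summit.AnomalousDissipation.AnomalousDissipation.Theses.TaylorCertificates
open Summit.AnomalousDissipation.AnomalousDissipation.Theorems.TargetImpliesSteadyDirect

/-! ## The pinch on atoms and the coupled budgets -/

/-- **The pinch on atoms: every steady state of the witness force is loud, bounded and rough.** If the FLOOR block
of `X` (multiplier `(Φ₁, θ₁)`, no sign needed here) and its CEILING hold at `(f, ε₀, E, ν)` (`ν > 0`, `f ∈ L²`),
then every steady weak solution `u ∈ V` of `NS_ν(f)` has `ε₀ ≤ ν‖∇u‖² = (u, f) ≤ |u| ‖f‖₂`, `|u|² ≤ E` (its Dirac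
mass is a stationary statistical solution) and enstrophy `‖∇u‖² ≥ ε₀/ν`. -/
theorem steady_pinch {ν : ℝ} (hν : 0 < ν) {f : (UnitAddTorus (Fin 3) → EuclideanSpace ℝ (Fin 3))} (hf : MemLp f 2 volume) {ε₀ E θ₁ : ℝ}
    {Φ₁ : Torus.CylindricalTest (Fin 3)}
    (hfloor : ∀ u : Torus.energySpace (Fin 3),
        Torus.eGradNormSq ((u : Lp (EuclideanSpace ℝ (Fin 3)) 2 (volume : Measure (UnitAddTorus (Fin 3)))) : UnitAddTorus (Fin 3) → EuclideanSpace ℝ (Fin 3)) ≠ ⊤ →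
        ‖u‖ ^ 2 ≤ 16 * (∫ x, ‖f x‖ ^ 2) / ν ^ 2 →
        ε₀ ≤ ν * (Torus.eGradNormSq ((u : Lp (EuclideanSpace ℝ (Fin 3)) 2 (volume : Measure (UnitAddTorus (Fin 3)))) : UnitAddTorus (Fin 3) → EuclideanSpace ℝ (Fin 3))).toReal + Torus.nsGeneratorPairing ν f u (Φ₁.grad u) +
          2 * θ₁ * (Torus.pairing (u : Lp (EuclideanSpace ℝ (Fin 3)) 2 (volume : Measure (UnitAddTorus (Fin 3)))) f - ν * (Torus.eGradNormSq ((u : Lp (EuclideanSpace ℝ (Fin 3)) 2 (volume : Measure (UnitAddTorus (Fin 3)))) : UnitAddTorus (Fin 3) → EuclideanSpace ℝ (Fin 3))).toReal))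
    (hceil : ∀ μ : Measure (Torus.energySpace (Fin 3)), Torus.IsStationaryStatisticalSolution ν f μ →
        Integrable (fun v : Torus.energySpace (Fin 3) => ‖v‖ ^ 2) μ → Torus.ensembleEnergy μ ≤ E)
    {u : Torus.energySpace (Fin 3)} (hV : (u : Lp (EuclideanSpace ℝ (Fin 3)) 2 (volume : Measure (UnitAddTorus (Fin 3)))) ∈ Torus.energySpaceV (Fin 3))
    (hu : Torus.IsSteadyWeakSolution ν f u) :
    ε₀ ≤ ν * (Torus.eGradNormSq ((u : Lp (EuclideanSpace ℝ (Fin 3)) 2 (volume : Measure (UnitAddTorus (Fin 3)))) : UnitAddTorus (Fin 3) → EuclideanSpace ℝ (Fin 3))).toReal ∧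
      ν * (Torus.eGradNormSq ((u : Lp (EuclideanSpace ℝ (Fin 3)) 2 (volume : Measure (UnitAddTorus (Fin 3)))) : UnitAddTorus (Fin 3) → EuclideanSpace ℝ (Fin 3))).toReal = Torus.pairing (u : Lp (EuclideanSpace ℝ (Fin 3)) 2 (volume : Measure (UnitAddTorus (Fin 3)))) f ∧
      Torus.pairing (u : Lp (EuclideanSpace ℝ (Fin 3)) 2 (volume : Measure (UnitAddTorus (Fin 3)))) f ≤ ‖u‖ * ‖hf.toLp f‖ ∧ ‖u‖ ^ 2 ≤ E ∧
      ε₀ / ν ≤ (Torus.eGradNormSq ((u : Lp (EuclideanSpace ℝ (Fin 3)) 2 (volume : Measure (UnitAddTorus (Fin 3)))) : UnitAddTorus (Fin 3) → EuclideanSpace ℝ (Fin 3))).toReal := by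
  have h1 : ε₀ ≤ ν * (Torus.eGradNormSq ((u : Lp (EuclideanSpace ℝ (Fin 3)) 2 (volume : Measure (UnitAddTorus (Fin 3)))) : UnitAddTorus (Fin 3) → EuclideanSpace ℝ (Fin 3))).toReal :=
    floor_le_dissipation_of_steady hν hf hfloor hV hu
  have h2 : ν * (Torus.eGradNormSq ((u : Lp (EuclideanSpace ℝ (Fin 3)) 2 (volume : Measure (UnitAddTorus (Fin 3)))) : UnitAddTorus (Fin 3) → EuclideanSpace ℝ (Fin 3))).toReal = Torus.pairing (u : Lp (EuclideanSpace ℝ (Fin 3)) 2 (volume : Measure (UnitAddTorus (Fin 3)))) f :=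
    Torus.IsSteadyWeakSolution.energy_eq' (by simp) hf hV hu
  have h3 : Torus.pairing (u : Lp (EuclideanSpace ℝ (Fin 3)) 2 (volume : Measure (UnitAddTorus (Fin 3)))) f ≤ ‖u‖ * ‖hf.toLp f‖ :=
    (le_abs_self _).trans (Torus.abs_pairing_coe_le hf u)
  have h4 : ‖u‖ ^ 2 ≤ E := norm_sq_le_of_ensemble_ceiling hν hf hceil hV hu
  refine ⟨h1, h2, h3, h4, ?_⟩
  rw [div_le_iff₀ hν, mul_comm]
  exact h1

/-- **The budgets of the crux are coupled**: if FLOOR ∧ CEILING hold at one `ν > 0` with `ε₀ > 0`, then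
`ε₀² ≤ ‖f‖₂² E` and `0 < E` (apply `steady_pinch` to a Leray–Temam steady state, which exists at every `ν`). -/
theorem pair_constants {ν : ℝ} (hν : 0 < ν) {f : (UnitAddTorus (Fin 3) → EuclideanSpace ℝ (Fin 3))} (hf : MemLp f 2 volume) {ε₀ E : ℝ} (hε₀ : 0 < ε₀)
    (hpair : (∃ (Φ₁ : Torus.CylindricalTest (Fin 3)) (θ₁ : ℝ), θ₁ ≤ 0 ∧ ∀ u : Torus.energySpace (Fin 3),
        Torus.eGradNormSq ((u : Lp (EuclideanSpace ℝ (Fin 3)) 2 (volume : Measure (UnitAddTorus (Fin 3)))) : UnitAddTorus (Fin 3) → EuclideanSpace ℝ (Fin 3)) ≠ ⊤ →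
        ‖u‖ ^ 2 ≤ 16 * (∫ x, ‖f x‖ ^ 2) / ν ^ 2 →
        ε₀ ≤ ν * (Torus.eGradNormSq ((u : Lp (EuclideanSpace ℝ (Fin 3)) 2 (volume : Measure (UnitAddTorus (Fin 3)))) : UnitAddTorus (Fin 3) → EuclideanSpace ℝ (Fin 3))).toReal + Torus.nsGeneratorPairing ν f u (Φ₁.grad u) +
          2 * θ₁ * (Torus.pairing (u : Lp (EuclideanSpace ℝ (Fin 3)) 2 (volume : Measure (UnitAddTorus (Fin 3)))) f - ν * (Torus.eGradNormSq ((u : Lp (EuclideanSpace ℝ (Fin 3)) 2 (volume : Measure (UnitAddTorus (Fin 3)))) : UnitAddTorus (Fin 3) → EuclideanSpace ℝ (Fin 3))).toReal)) ∧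
      (∀ μ : Measure (Torus.energySpace (Fin 3)), Torus.IsStationaryStatisticalSolution ν f μ →
        Integrable (fun v : Torus.energySpace (Fin 3) => ‖v‖ ^ 2) μ → Torus.ensembleEnergy μ ≤ E)) :
    ε₀ ^ 2 ≤ (∫ x, ‖f x‖ ^ 2) * E ∧ 0 < E := by
  obtain ⟨⟨Φ₁, θ₁, -, hfloor⟩, hceil⟩ := hpair
  obtain ⟨u, hV, hu⟩ := Torus.Temam1979_exists_steadyWeakSolution_holds (by simp) hν hf
  obtain ⟨h1, h2, h3, h4, -⟩ := steady_pinch hν hf hfloor hceil hV hu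
  have hF : ‖hf.toLp f‖ ^ 2 = ∫ x, ‖f x‖ ^ 2 := by
    rw [Torus.norm_toLp_eq_sqrt hf, Real.sq_sqrt (integral_nonneg fun x => by positivity)]
  have h5 : ε₀ ≤ ‖u‖ * ‖hf.toLp f‖ := by linarith
  have h6 : ε₀ ^ 2 ≤ (‖u‖ * ‖hf.toLp f‖) ^ 2 := pow_le_pow_left₀ hε₀.le h5 2
  rw [mul_pow, hF] at h6
  have hFnn : 0 ≤ ∫ x, ‖f x‖ ^ 2 := integral_nonneg fun x => by positivity
  have h7 : ‖u‖ ^ 2 * (∫ x, ‖f x‖ ^ 2) ≤ E * (∫ x, ‖f x‖ ^ 2) := mul_le_mul_of_nonneg_right h4 hFnn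
  refine ⟨by nlinarith, ?_⟩
  have hu0 : 0 < ‖u‖ := by
    by_contra h0
    have h0' : ‖u‖ = 0 := le_antisymm (not_lt.1 h0) (norm_nonneg _)
    rw [h0', zero_mul] at h5
    linarith
  nlinarith

/-- **The floor excludes the trivial force** (although `X` does not say `f ≠ 0`): FLOOR ∧ CEILING at one `ν > 0`
with `ε₀ > 0` force `‖f‖₂² > 0`. -/
theorem force_pos_of_pair {ν : ℝ} (hν : 0 < ν) {f : (UnitAddTorus (Fin 3) → EuclideanSpace ℝ (Fin 3))} (hf : MemLp f 2 volume) {ε₀ E : ℝ} (hε₀ : 0 < ε₀)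
    (hpair : (∃ (Φ₁ : Torus.CylindricalTest (Fin 3)) (θ₁ : ℝ), θ₁ ≤ 0 ∧ ∀ u : Torus.energySpace (Fin 3),
        Torus.eGradNormSq ((u : Lp (EuclideanSpace ℝ (Fin 3)) 2 (volume : Measure (UnitAddTorus (Fin 3)))) : UnitAddTorus (Fin 3) → EuclideanSpace ℝ (Fin 3)) ≠ ⊤ →
        ‖u‖ ^ 2 ≤ 16 * (∫ x, ‖f x‖ ^ 2) / ν ^ 2 →
        ε₀ ≤ ν * (Torus.eGradNormSq ((u : Lp (EuclideanSpace ℝ (Fin 3)) 2 (volume : Measure (UnitAddTorus (Fin 3)))) : UnitAddTorus (Fin 3) → EuclideanSpace ℝ (Fin 3))).toReal + Torus.nsGeneratorPairing ν f u (Φ₁.grad u) +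
          2 * θ₁ * (Torus.pairing (u : Lp (EuclideanSpace ℝ (Fin 3)) 2 (volume : Measure (UnitAddTorus (Fin 3)))) f - ν * (Torus.eGradNormSq ((u : Lp (EuclideanSpace ℝ (Fin 3)) 2 (volume : Measure (UnitAddTorus (Fin 3)))) : UnitAddTorus (Fin 3) → EuclideanSpace ℝ (Fin 3))).toReal)) ∧
      (∀ μ : Measure (Torus.energySpace (Fin 3)), Torus.IsStationaryStatisticalSolution ν f μ →
        Integrable (fun v : Torus.energySpace (Fin 3) => ‖v‖ ^ 2) μ → Torus.ensembleEnergy μ ≤ E)) :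
    0 < ∫ x, ‖f x‖ ^ 2 := by
  obtain ⟨h1, -⟩ := pair_constants hν hf hε₀ hpair
  by_contra h0
  have h0' : ∫ x, ‖f x‖ ^ 2 ≤ 0 := not_lt.1 h0
  have hFnn : 0 ≤ ∫ x, ‖f x‖ ^ 2 := integral_nonneg fun x => by positivity
  have hF0 : ∫ x, ‖f x‖ ^ 2 = 0 := le_antisymm h0' hFnn
  rw [hF0, zero_mul] at h1
  nlinarith [mul_pos hε₀ hε₀]

/-- The coupled budgets, read on the crux: any witness `(f, ε₀, E, ν₀)` of `X` has `f ≠ 0`, `E > 0` and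
`ε₀² ≤ ‖f‖₂² E`. -/
theorem target_constants (h : FloorCertificateEnsembleCeiling) :
    ∃ f : (UnitAddTorus (Fin 3) → EuclideanSpace ℝ (Fin 3)), Torus.IsSmooth f ∧ Torus.IsDivFree f ∧ Torus.HasZeroMean f ∧ 0 < (∫ x, ‖f x‖ ^ 2) ∧
      ∃ (ε₀ E ν₀ : ℝ), 0 < ε₀ ∧ 0 < ν₀ ∧ 0 < E ∧ ε₀ ^ 2 ≤ (∫ x, ‖f x‖ ^ 2) * E ∧ ∀ ν : ℝ, 0 < ν → ν < ν₀ →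
      (∃ (Φ₁ : Torus.CylindricalTest (Fin 3)) (θ₁ : ℝ), θ₁ ≤ 0 ∧ ∀ u : Torus.energySpace (Fin 3),
        Torus.eGradNormSq ((u : Lp (EuclideanSpace ℝ (Fin 3)) 2 (volume : Measure (UnitAddTorus (Fin 3)))) : UnitAddTorus (Fin 3) → EuclideanSpace ℝ (Fin 3)) ≠ ⊤ →
        ‖u‖ ^ 2 ≤ 16 * (∫ x, ‖f x‖ ^ 2) / ν ^ 2 →
        ε₀ ≤ ν * (Torus.eGradNormSq ((u : Lp (EuclideanSpace ℝ (Fin 3)) 2 (volume : Measure (UnitAddTorus (Fin 3)))) : UnitAddTorus (Fin 3) → EuclideanSpace ℝ (Fin 3))).toReal + Torus.nsGeneratorPairing ν f u (Φ₁.grad u) +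
          2 * θ₁ * (Torus.pairing (u : Lp (EuclideanSpace ℝ (Fin 3)) 2 (volume : Measure (UnitAddTorus (Fin 3)))) f - ν * (Torus.eGradNormSq ((u : Lp (EuclideanSpace ℝ (Fin 3)) 2 (volume : Measure (UnitAddTorus (Fin 3)))) : UnitAddTorus (Fin 3) → EuclideanSpace ℝ (Fin 3))).toReal)) ∧
      (∀ μ : Measure (Torus.energySpace (Fin 3)), Torus.IsStationaryStatisticalSolution ν f μ →
        Integrable (fun v : Torus.energySpace (Fin 3) => ‖v‖ ^ 2) μ → Torus.ensembleEnergy μ ≤ E) := by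
  obtain ⟨f, hfs, hfd, hfz, ε₀, E, ν₀, hε₀, hν₀, h⟩ := h
  have hc := pair_constants (half_pos hν₀) (hfs.memLp 2) hε₀ (h (ν₀ / 2) (half_pos hν₀) (by linarith))
  exact ⟨f, hfs, hfd, hfz, force_pos_of_pair (half_pos hν₀) (hfs.memLp 2) hε₀ (h (ν₀ / 2) (half_pos hν₀) (by linarith)),
    ε₀, E, ν₀, hε₀, hν₀, hc.2, hc.1, h⟩

/-- **No super-laminar floor, for any force** (a refuted natural strengthening of `X`): the certified dissipation
floor can never exceed the laminar power available at the ceiling energy, i.e. `‖f‖₂² E < ε₀²` is impossible —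
on the Dirac mass of a Leray–Temam steady state the floor gives `ε₀ ≤ (u,f) ≤ ‖u‖‖f‖₂` and the ceiling `‖u‖² ≤ E`. -/
theorem floorCertificateEnsembleCeiling_superLaminar_false :
    ¬ ∃ f : (UnitAddTorus (Fin 3) → EuclideanSpace ℝ (Fin 3)), Torus.IsSmooth f ∧ Torus.IsDivFree f ∧ Torus.HasZeroMean f ∧
      ∃ (ε₀ E ν₀ : ℝ), 0 < ε₀ ∧ 0 < ν₀ ∧ (∫ x, ‖f x‖ ^ 2) * E < ε₀ ^ 2 ∧ ∀ ν : ℝ, 0 < ν → ν < ν₀ →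
      (∃ (Φ₁ : Torus.CylindricalTest (Fin 3)) (θ₁ : ℝ), θ₁ ≤ 0 ∧ ∀ u : Torus.energySpace (Fin 3),
        Torus.eGradNormSq ((u : Lp (EuclideanSpace ℝ (Fin 3)) 2 (volume : Measure (UnitAddTorus (Fin 3)))) : UnitAddTorus (Fin 3) → EuclideanSpace ℝ (Fin 3)) ≠ ⊤ →
        ‖u‖ ^ 2 ≤ 16 * (∫ x, ‖f x‖ ^ 2) / ν ^ 2 →
        ε₀ ≤ ν * (Torus.eGradNormSq ((u : Lp (EuclideanSpace ℝ (Fin 3)) 2 (volume : Measure (UnitAddTorus (Fin 3)))) : UnitAddTorus (Fin 3) → EuclideanSpace ℝ (Fin 3))).toReal + Torus.nsGeneratorPairing ν f u (Φ₁.grad u) +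
          2 * θ₁ * (Torus.pairing (u : Lp (EuclideanSpace ℝ (Fin 3)) 2 (volume : Measure (UnitAddTorus (Fin 3)))) f - ν * (Torus.eGradNormSq ((u : Lp (EuclideanSpace ℝ (Fin 3)) 2 (volume : Measure (UnitAddTorus (Fin 3)))) : UnitAddTorus (Fin 3) → EuclideanSpace ℝ (Fin 3))).toReal)) ∧
      (∀ μ : Measure (Torus.energySpace (Fin 3)), Torus.IsStationaryStatisticalSolution ν f μ →
        Integrable (fun v : Torus.energySpace (Fin 3) => ‖v‖ ^ 2) μ → Torus.ensembleEnergy μ ≤ E) := by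
  rintro ⟨f, hfs, -, -, ε₀, E, ν₀, hε₀, hν₀, hlt, h⟩
  have hc := pair_constants (half_pos hν₀) (hfs.memLp 2) hε₀ (h (ν₀ / 2) (half_pos hν₀) (by linarith))
  linarith [hc.1]

/-- **The cheapest crux is necessary for the target (negative form).** A refutation of the route's crux #3
`SteadyStatesLoudBounded` (stmt-13038) refutes `X` (the positive form is the route support `TargetImpliesSteady`,
proved in `TaylorCertificatesTargetImpliesSteadyDirect`: classical steady states lift to `V`, then `steady_pinch`). -/
theorem target_false_of_not_steadyStatesLoudBounded (h : ¬ SteadyStatesLoudBounded) :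
    ¬ FloorCertificateEnsembleCeiling :=
  fun hX => h (Summit.AnomalousDissipation.AnomalousDissipation.Theorems.TargetImpliesSteady_direct_proof hX)

/-! ## Load-bearing: small viscosity (low-Reynolds laminar states are quiet) -/

/-- **Low-Reynolds steady states are quiet**: every steady weak solution `u ∈ V` of `NS_ν(f)` has
`ν‖∇u‖² ≤ ‖f‖₂²/(4π²ν)` (energy equation `ν‖∇u‖² = (u,f) ≤ |u|‖f‖₂` and Poincaré `4π²|u|² ≤ ‖∇u‖²`). TIGHT: the
laminar state of a single-mode gravest-shell force attains it. -/
theorem steady_dissipation_le {ν : ℝ} (hν : 0 < ν) {f : (UnitAddTorus (Fin 3) → EuclideanSpace ℝ (Fin 3))} (hf : MemLp f 2 volume) {u : Torus.energySpace (Fin 3)}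
    (hV : (u : Lp (EuclideanSpace ℝ (Fin 3)) 2 (volume : Measure (UnitAddTorus (Fin 3)))) ∈ Torus.energySpaceV (Fin 3)) (hu : Torus.IsSteadyWeakSolution ν f u) :
    ν * (Torus.eGradNormSq ((u : Lp (EuclideanSpace ℝ (Fin 3)) 2 (volume : Measure (UnitAddTorus (Fin 3)))) : UnitAddTorus (Fin 3) → EuclideanSpace ℝ (Fin 3))).toReal ≤ ‖hf.toLp f‖ ^ 2 / (4 * Real.pi ^ 2 * ν) := by
  set G : ℝ := (Torus.eGradNormSq ((u : Lp (EuclideanSpace ℝ (Fin 3)) 2 (volume : Measure (UnitAddTorus (Fin 3)))) : UnitAddTorus (Fin 3) → EuclideanSpace ℝ (Fin 3))).toReal with hG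
  have hfin : Torus.eGradNormSq ((u : Lp (EuclideanSpace ℝ (Fin 3)) 2 (volume : Measure (UnitAddTorus (Fin 3)))) : UnitAddTorus (Fin 3) → EuclideanSpace ℝ (Fin 3)) ≠ ⊤ := hV.2.eGradNormSq_lt_top.ne
  have hG0 : 0 ≤ G := ENNReal.toReal_nonneg
  have henergy : ν * G = Torus.pairing (u : Lp (EuclideanSpace ℝ (Fin 3)) 2 (volume : Measure (UnitAddTorus (Fin 3)))) f := Torus.IsSteadyWeakSolution.energy_eq' (by simp) hf hV hu
  have hpair : Torus.pairing (u : Lp (EuclideanSpace ℝ (Fin 3)) 2 (volume : Measure (UnitAddTorus (Fin 3)))) f ≤ ‖u‖ * ‖hf.toLp f‖ := (le_abs_self _).trans (Torus.abs_pairing_coe_le hf u)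
  have hP : 4 * Real.pi ^ 2 * ‖u‖ ^ 2 ≤ G := Torus.norm_sq_le_toReal_eGradNormSq u hfin
  have hlam : 0 < 4 * Real.pi ^ 2 * ν := by positivity
  rw [le_div_iff₀ hlam]
  have h1 : ν * G ≤ ‖u‖ * ‖hf.toLp f‖ := henergy ▸ hpair
  have h2 : (ν * G) ^ 2 ≤ ‖u‖ ^ 2 * ‖hf.toLp f‖ ^ 2 := by
    rw [← mul_pow]; exact pow_le_pow_left₀ (by positivity) h1 2
  have h3 : 4 * Real.pi ^ 2 * (ν * G) ^ 2 ≤ G * ‖hf.toLp f‖ ^ 2 := by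
    calc 4 * Real.pi ^ 2 * (ν * G) ^ 2 ≤ 4 * Real.pi ^ 2 * (‖u‖ ^ 2 * ‖hf.toLp f‖ ^ 2) :=
          mul_le_mul_of_nonneg_left h2 (by positivity)
      _ = (4 * Real.pi ^ 2 * ‖u‖ ^ 2) * ‖hf.toLp f‖ ^ 2 := by ring
      _ ≤ G * ‖hf.toLp f‖ ^ 2 := mul_le_mul_of_nonneg_right hP (sq_nonneg _)
  by_cases hG0' : G = 0
  · rw [hG0', mul_zero, zero_mul]; positivity
  · have hGpos : 0 < G := lt_of_le_of_ne hG0 (Ne.symm hG0')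
    have h4 : 4 * Real.pi ^ 2 * ν ^ 2 * G ≤ ‖hf.toLp f‖ ^ 2 := by
      have : G * (4 * Real.pi ^ 2 * ν ^ 2 * G) ≤ G * ‖hf.toLp f‖ ^ 2 := by nlinarith
      exact le_of_mul_le_mul_left this hGpos
    nlinarith

/-- **No floor at low Reynolds number, for any force**: if `‖f‖₂²/(4π²ν) < ε₀` then NO multiplier `(Φ₁, θ₁)`
satisfies the FLOOR block with budget `ε₀` at `ν` — the Leray–Temam steady state is quiet there (`steady_dissipation_le`)
while a floor makes every steady state `ε₀`-loud (`floor_le_dissipation_of_steady`). No sign condition on `θ₁`. -/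
theorem not_floor_of_large_viscosity {ν : ℝ} (hν : 0 < ν) {f : (UnitAddTorus (Fin 3) → EuclideanSpace ℝ (Fin 3))} (hf : MemLp f 2 volume) {ε₀ θ₁ : ℝ}
    {Φ₁ : Torus.CylindricalTest (Fin 3)} (h : ‖hf.toLp f‖ ^ 2 / (4 * Real.pi ^ 2 * ν) < ε₀)
    (hfloor : ∀ u : Torus.energySpace (Fin 3),
        Torus.eGradNormSq ((u : Lp (EuclideanSpace ℝ (Fin 3)) 2 (volume : Measure (UnitAddTorus (Fin 3)))) : UnitAddTorus (Fin 3) → EuclideanSpace ℝ (Fin 3)) ≠ ⊤ →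
        ‖u‖ ^ 2 ≤ 16 * (∫ x, ‖f x‖ ^ 2) / ν ^ 2 →
        ε₀ ≤ ν * (Torus.eGradNormSq ((u : Lp (EuclideanSpace ℝ (Fin 3)) 2 (volume : Measure (UnitAddTorus (Fin 3)))) : UnitAddTorus (Fin 3) → EuclideanSpace ℝ (Fin 3))).toReal + Torus.nsGeneratorPairing ν f u (Φ₁.grad u) +
          2 * θ₁ * (Torus.pairing (u : Lp (EuclideanSpace ℝ (Fin 3)) 2 (volume : Measure (UnitAddTorus (Fin 3)))) f - ν * (Torus.eGradNormSq ((u : Lp (EuclideanSpace ℝ (Fin 3)) 2 (volume : Measure (UnitAddTorus (Fin 3)))) : UnitAddTorus (Fin 3) → EuclideanSpace ℝ (Fin 3))).toReal)) : False := by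
  obtain ⟨u, hV, hu⟩ := Torus.Temam1979_exists_steadyWeakSolution_holds (by simp) hν hf
  have h1 := floor_le_dissipation_of_steady hν hf hfloor hV hu
  have h2 := steady_dissipation_le hν hf hV hu
  linarith

/-- **The floor budget is bounded by the laminar dissipation**: a FLOOR block with budget `ε₀` at `(f, ν)` has
`ε₀ ≤ ‖f‖₂²/(4π²ν)` (so `ε₀ ν ≤ ‖f‖₂²/(4π²)` along any floor family — the certified floor dies linearly as `ν` grows). -/
theorem floor_budget_le {ν : ℝ} (hν : 0 < ν) {f : (UnitAddTorus (Fin 3) → EuclideanSpace ℝ (Fin 3))} (hf : MemLp f 2 volume) {ε₀ θ₁ : ℝ}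
    {Φ₁ : Torus.CylindricalTest (Fin 3)}
    (hfloor : ∀ u : Torus.energySpace (Fin 3),
        Torus.eGradNormSq ((u : Lp (EuclideanSpace ℝ (Fin 3)) 2 (volume : Measure (UnitAddTorus (Fin 3)))) : UnitAddTorus (Fin 3) → EuclideanSpace ℝ (Fin 3)) ≠ ⊤ →
        ‖u‖ ^ 2 ≤ 16 * (∫ x, ‖f x‖ ^ 2) / ν ^ 2 →
        ε₀ ≤ ν * (Torus.eGradNormSq ((u : Lp (EuclideanSpace ℝ (Fin 3)) 2 (volume : Measure (UnitAddTorus (Fin 3)))) : UnitAddTorus (Fin 3) → EuclideanSpace ℝ (Fin 3))).toReal + Torus.nsGeneratorPairing ν f u (Φ₁.grad u) +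
          2 * θ₁ * (Torus.pairing (u : Lp (EuclideanSpace ℝ (Fin 3)) 2 (volume : Measure (UnitAddTorus (Fin 3)))) f - ν * (Torus.eGradNormSq ((u : Lp (EuclideanSpace ℝ (Fin 3)) 2 (volume : Measure (UnitAddTorus (Fin 3)))) : UnitAddTorus (Fin 3) → EuclideanSpace ℝ (Fin 3))).toReal)) :
    ε₀ ≤ ‖hf.toLp f‖ ^ 2 / (4 * Real.pi ^ 2 * ν) := by
  by_contra hlt
  exact not_floor_of_large_viscosity hν hf (not_le.1 hlt) hfloor

/-- **LOAD-BEARING: small viscosity.** With the restriction `ν < ν₀` dropped, `X` is FALSE for every force: at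
`ν = ‖f‖₂²/(4π²ε₀) + 1` the laminar (Leray–Temam) steady state dissipates less than `ε₀`, so no FLOOR block exists
there (`not_floor_of_large_viscosity`); the CEILING half is not even used. -/
theorem floorCertificateEnsembleCeiling_false_without_smallViscosity :
    ¬ ∃ f : (UnitAddTorus (Fin 3) → EuclideanSpace ℝ (Fin 3)), Torus.IsSmooth f ∧ Torus.IsDivFree f ∧ Torus.HasZeroMean f ∧
      ∃ (ε₀ E : ℝ), 0 < ε₀ ∧ ∀ ν : ℝ, 0 < ν →
      (∃ (Φ₁ : Torus.CylindricalTest (Fin 3)) (θ₁ : ℝ), θ₁ ≤ 0 ∧ ∀ u : Torus.energySpace (Fin 3),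
        Torus.eGradNormSq ((u : Lp (EuclideanSpace ℝ (Fin 3)) 2 (volume : Measure (UnitAddTorus (Fin 3)))) : UnitAddTorus (Fin 3) → EuclideanSpace ℝ (Fin 3)) ≠ ⊤ →
        ‖u‖ ^ 2 ≤ 16 * (∫ x, ‖f x‖ ^ 2) / ν ^ 2 →
        ε₀ ≤ ν * (Torus.eGradNormSq ((u : Lp (EuclideanSpace ℝ (Fin 3)) 2 (volume : Measure (UnitAddTorus (Fin 3)))) : UnitAddTorus (Fin 3) → EuclideanSpace ℝ (Fin 3))).toReal + Torus.nsGeneratorPairing ν f u (Φ₁.grad u) +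
          2 * θ₁ * (Torus.pairing (u : Lp (EuclideanSpace ℝ (Fin 3)) 2 (volume : Measure (UnitAddTorus (Fin 3)))) f - ν * (Torus.eGradNormSq ((u : Lp (EuclideanSpace ℝ (Fin 3)) 2 (volume : Measure (UnitAddTorus (Fin 3)))) : UnitAddTorus (Fin 3) → EuclideanSpace ℝ (Fin 3))).toReal)) ∧
      (∀ μ : Measure (Torus.energySpace (Fin 3)), Torus.IsStationaryStatisticalSolution ν f μ →
        Integrable (fun v : Torus.energySpace (Fin 3) => ‖v‖ ^ 2) μ → Torus.ensembleEnergy μ ≤ E) := by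
  rintro ⟨f, hfs, -, -, ε₀, E, hε₀, h⟩
  have hf : MemLp f 2 volume := hfs.memLp 2
  set F : ℝ := ‖hf.toLp f‖ ^ 2 with hF
  have hF0 : 0 ≤ F := sq_nonneg _
  set ν : ℝ := F / (4 * Real.pi ^ 2 * ε₀) + 1 with hνdef
  have hν : 0 < ν := by positivity
  obtain ⟨⟨Φ₁, θ₁, -, hfloor⟩, -⟩ := h ν hν
  refine not_floor_of_large_viscosity hν hf ?_ hfloor
  rw [div_lt_iff₀ (by positivity)]
  have h1 : F = ε₀ * (4 * Real.pi ^ 2 * (F / (4 * Real.pi ^ 2 * ε₀))) := by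
    field_simp
  have h2 : 4 * Real.pi ^ 2 * (F / (4 * Real.pi ^ 2 * ε₀)) < 4 * Real.pi ^ 2 * ν := by
    rw [hνdef]; nlinarith [Real.pi_pos]
  nlinarith

/-! ## The exact steady adversary (OPEN hypothesis): quiet OR fat steady states for every force -/

/-- A quiet-or-fat steady state at `ν` breaks FLOOR ∧ CEILING at `ν`. -/
theorem not_pair_of_quietOrFat_steady {ν : ℝ} (hν : 0 < ν) {f : (UnitAddTorus (Fin 3) → EuclideanSpace ℝ (Fin 3))} (hf : MemLp f 2 volume) {ε₀ E : ℝ}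
    {u : Torus.energySpace (Fin 3)} (hV : (u : Lp (EuclideanSpace ℝ (Fin 3)) 2 (volume : Measure (UnitAddTorus (Fin 3)))) ∈ Torus.energySpaceV (Fin 3)) (hu : Torus.IsSteadyWeakSolution ν f u)
    (hq : ν * (Torus.eGradNormSq ((u : Lp (EuclideanSpace ℝ (Fin 3)) 2 (volume : Measure (UnitAddTorus (Fin 3)))) : UnitAddTorus (Fin 3) → EuclideanSpace ℝ (Fin 3))).toReal < ε₀ ∨ E < ‖u‖ ^ 2)
    (hpair : (∃ (Φ₁ : Torus.CylindricalTest (Fin 3)) (θ₁ : ℝ), θ₁ ≤ 0 ∧ ∀ u : Torus.energySpace (Fin 3),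
        Torus.eGradNormSq ((u : Lp (EuclideanSpace ℝ (Fin 3)) 2 (volume : Measure (UnitAddTorus (Fin 3)))) : UnitAddTorus (Fin 3) → EuclideanSpace ℝ (Fin 3)) ≠ ⊤ →
        ‖u‖ ^ 2 ≤ 16 * (∫ x, ‖f x‖ ^ 2) / ν ^ 2 →
        ε₀ ≤ ν * (Torus.eGradNormSq ((u : Lp (EuclideanSpace ℝ (Fin 3)) 2 (volume : Measure (UnitAddTorus (Fin 3)))) : UnitAddTorus (Fin 3) → EuclideanSpace ℝ (Fin 3))).toReal + Torus.nsGeneratorPairing ν f u (Φ₁.grad u) +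
          2 * θ₁ * (Torus.pairing (u : Lp (EuclideanSpace ℝ (Fin 3)) 2 (volume : Measure (UnitAddTorus (Fin 3)))) f - ν * (Torus.eGradNormSq ((u : Lp (EuclideanSpace ℝ (Fin 3)) 2 (volume : Measure (UnitAddTorus (Fin 3)))) : UnitAddTorus (Fin 3) → EuclideanSpace ℝ (Fin 3))).toReal)) ∧
      (∀ μ : Measure (Torus.energySpace (Fin 3)), Torus.IsStationaryStatisticalSolution ν f μ →
        Integrable (fun v : Torus.energySpace (Fin 3) => ‖v‖ ^ 2) μ → Torus.ensembleEnergy μ ≤ E)) : False := by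
  obtain ⟨⟨Φ₁, θ₁, -, hfloor⟩, hceil⟩ := hpair
  obtain ⟨h1, -, -, h4, -⟩ := steady_pinch hν hf hfloor hceil hV hu
  rcases hq with hq | hq <;> linarith

/-- **Negative lemma modulo the steady adversary** (Dirac weak duality; NOT a refutation — the hypothesis is the
open inverse-design question of the route): IF every admissible `f ≠ 0` has, for every box `(ε₀, E)` and at
arbitrarily small `ν`, a steady weak solution `u ∈ V` of `NS_ν(f)` that is QUIET (`ν‖∇u‖² < ε₀`) or FAT (`|u|² > E`),
then `X` is false. The known instances are force-class-specific (fat: Euler-steady gravest shell — single mode,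
Beltrami/ABC, orthogonal shears, planar cellular; quiet side: planar forces by Alexakis–Doering); a genuinely
three-dimensional multi-mode force with neither branch is exactly what `X` bets on. -/
theorem target_false_of_quietOrFatSteadyStates
    (hQ : ∀ f : (UnitAddTorus (Fin 3) → EuclideanSpace ℝ (Fin 3)), Torus.IsSmooth f → Torus.IsDivFree f → Torus.HasZeroMean f →
      0 < (∫ x, ‖f x‖ ^ 2) → ∀ ε₀ E ν₀ : ℝ, 0 < ε₀ → 0 < ν₀ → ∃ ν : ℝ, 0 < ν ∧ ν < ν₀ ∧
        ∃ u : Torus.energySpace (Fin 3), (u : Lp (EuclideanSpace ℝ (Fin 3)) 2 (volume : Measure (UnitAddTorus (Fin 3)))) ∈ Torus.energySpaceV (Fin 3) ∧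
          Torus.IsSteadyWeakSolution ν f u ∧
          (ν * (Torus.eGradNormSq ((u : Lp (EuclideanSpace ℝ (Fin 3)) 2 (volume : Measure (UnitAddTorus (Fin 3)))) : UnitAddTorus (Fin 3) → EuclideanSpace ℝ (Fin 3))).toReal < ε₀ ∨ E < ‖u‖ ^ 2)) :
    ¬ FloorCertificateEnsembleCeiling := by
  rintro ⟨f, hfs, hfd, hfz, ε₀, E, ν₀, hε₀, hν₀, h⟩
  have hf2 : MemLp f 2 volume := hfs.memLp 2
  have hF : 0 < ∫ x, ‖f x‖ ^ 2 :=
    force_pos_of_pair (half_pos hν₀) hf2 hε₀ (h (ν₀ / 2) (half_pos hν₀) (by linarith))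
  obtain ⟨ν, hν, hνν₀, u, hV, hu, hq⟩ := hQ f hfs hfd hfz hF ε₀ E ν₀ hε₀ hν₀
  exact not_pair_of_quietOrFat_steady hν hf2 hV hu hq (h ν hν hνν₀)

end Summit.AnomalousDissipation.AnomalousDissipation.Theorems.FloorCertificateEnsembleCeiling.Negative

end
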